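import Summits.ResolutionOfSingularities.ResolutionOfSingularities.Theorems.FrobeniusClosingPatchingRelPerfectMonomialPolyhedraGameMarked
import Mathlib.Order.WellFounded
import HarnessLib

/-!
# Crux `PatchingRelPerfect` (stmt-ResolutionOfSingularities-16161), chain w52 — TargetsF3 (m)
# «M2-strong», COMBINATORIAL HALF, file 2c: the STRATEGY SOCKET with marking `m` and ALL fresh
# names — the shape Route K instantiates

[OURS · L1 W5.2 · res-L1-w52-plan-1 RULING M2 06:34:44Z + «Route K approved» 07:37:28Z; fact-free;
nothing here is a statement of the manuscript under review]

File 2b (`Strategy Θ Ω`) produces file 1's `Winnable 0` with the `fresh` naming policy.  The scheme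
dictionary consumes the positional/all-names notion `WinnableAll m` of file 1m, and Route K's
geometric data (a realisation of the state over `ℚ` together with the REMAINING part of Kollár's
functorial blow-up sequence) is naturally a memory that is good under EVERY fresh name (the name of
the exceptional divisor is a label).  `StrategyAll m Θ Ω` is that socket: memory `Θ`, well-formedness
`HWF`, prescribed centre `next`, update `upd s θ J e` for every fresh `e`, measure `μ` into a
well-ordered `Ω`, with the axioms «`none` only at `WonM m` states», «`some J` is `PermissibleM m`»,
«`HWF` and the drop of `μ` hold after the move `move s J e m` for EVERY `e ∉ B`».
Theorems: `StrategyAll.winnableAll` and `StrategyAll.routeKTarget` (if every well-formed state admits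
an initial memory then `RouteKTarget m`).
-/

-- `Summit.<Summit>.<Sub>.Theorems` with `Sub = Summit` (single-conjunct summit, D-0017)
set_option linter.dupNamespace false

namespace Summit.ResolutionOfSingularities.ResolutionOfSingularities.Theorems

namespace PolyhedraGame

/-- [OURS · W5.2 M2-strong] A deterministic permissible strategy WITH MEMORY for the marking-`m` game,
good under every fresh exceptional name (Route K's shape: `Θ` = realisation over `ℚ` + the remaining
functorial blow-up sequence, `μ` = its length). -/
structure StrategyAll (m : ℕ) (Θ Ω : Type*) [LT Ω] where
  /-- well-formed memory for a state -/
  HWF : State → Θ → Prop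
  /-- memory after blowing up `J` with exceptional name `e` -/
  upd : State → Θ → Finset ℕ → ℕ → Θ
  /-- the prescribed centre, or `none` to stop -/
  next : State → Θ → Option (Finset ℕ)
  /-- the termination measure -/
  μ : State → Θ → Ω
  /-- the strategy stops only at locally won states -/
  wonM_of_next_eq_none : ∀ s θ, s.WF → HWF s θ → next s θ = none → WonM m s
  /-- the prescribed centre is permissible with marking `m` -/
  permissibleM_of_next_eq_some : ∀ s θ J, s.WF → HWF s θ → next s θ = some J → PermissibleM m s J
  /-- memory well-formedness survives the prescribed move under every fresh name -/
  hwf_move : ∀ s θ J, s.WF → HWF s θ → next s θ = some J → ∀ e, e ∉ s.B →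
    HWF (move s J e m) (upd s θ J e)
  /-- the measure drops after the prescribed move under every fresh name -/
  μ_lt : ∀ s θ J, s.WF → HWF s θ → next s θ = some J → ∀ e, e ∉ s.B →
    μ (move s J e m) (upd s θ J e) < μ s θ

namespace StrategyAll

variable {m : ℕ} {Θ Ω : Type*} [LT Ω]

/-- [OURS · W5.2 M2-strong] **A strategy with memory, good under all fresh names, gives
`WinnableAll m`** (well-founded induction on the measure). -/
theorem winnableAll [WellFoundedLT Ω] (S : StrategyAll m Θ Ω) :
    ∀ (s : State) (θ : Θ), s.WF → S.HWF s θ → WinnableAll m s := by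
  suffices h : ∀ (o : Ω) (s : State) (θ : Θ), S.μ s θ = o → s.WF → S.HWF s θ → WinnableAll m s from
    fun s θ hs hθ => h _ s θ rfl hs hθ
  intro o
  induction o using WellFoundedLT.induction with
  | ind o ih =>
    intro s θ ho hs hθ
    cases hJ : S.next s θ with
    | none => exact WinnableAll.done (S.wonM_of_next_eq_none s θ hs hθ hJ)
    | some J =>
      refine WinnableAll.step J (S.permissibleM_of_next_eq_some s θ J hs hθ hJ) fun e he => ?_
      exact ih _ (ho ▸ S.μ_lt s θ J hs hθ hJ e he) _ _ rfl (WF.move hs J e m)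
        (S.hwf_move s θ J hs hθ hJ e he)

/-- [OURS · W5.2 M2-strong] If every well-formed state admits a well-formed initial memory, the
strategy discharges `RouteKTarget m`. -/
theorem routeKTarget [WellFoundedLT Ω] (S : StrategyAll m Θ Ω)
    (init : ∀ s : State, s.WF → ∃ θ, S.HWF s θ) : RouteKTarget m := by
  intro s hs
  obtain ⟨θ, hθ⟩ := init s hs
  exact S.winnableAll s θ hs hθ

end StrategyAll

end PolyhedraGame

end Summit.ResolutionOfSingularities.ResolutionOfSingularities.Theorems
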